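import Summits.BirchSwinnertonDyer.BirchSwinnertonDyer.Theorems.BiquadraticEisensteinDescentHeegnerTwistCouplingInSupplySqrtSevenCorner
import Literature.NumberTheory.EllipticCurves.Rank1Residual.Predicates
import Literature.NumberTheory.EllipticCurves.NoEverywhereGoodReductionRat
import HarnessLib

set_option linter.dupNamespace false -- `Summit.BirchSwinnertonDyer.BirchSwinnertonDyer.Theorems.…` (summit = sub)
set_option autoImplicit false

/-!
# Crux `HeegnerTwistCouplingInSupply` (stmt-BirchSwinnertonDyer-21381) — the `j = −3375` corner is a GENUINE INSTANCE: for every prime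
# `p ≡ 3, 19, 27 (mod 56)` the crux's own hypotheses `HasCM`, `CMInert W p`, `¬ Good W p` hold for `W_p = X₀(49)^{(−p)}`

Route `BiquadraticEisensteinDescent` (cell `pub/bsd-wall`, width seat `bsd-wall-cm-bed-w1` g11; `--supports` 21381, helper). Companion of `…SqrtSevenCorner`
(`cruxOnSqrtSevenCorner_of_two_facts`: the CONCLUSION of the crux for `W_p = ⟨1, −(21p+1)/4, 0, 7p², 0⟩`, every prime `p ≥ 5` with `p ≡ 3 (mod 8)`,
`p ≡ 3, 5, 6 (mod 7)`, modulo Burungale–Tian + Deuring–Hecke; `binders_W`: the instance binders `IsElliptic`, `IsGloballyMinimal`, `NeZero N`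
are inhabited). Here the remaining HYPOTHESES of the crux (`Theses/BiquadraticEisensteinDescent.lean`, decl `HeegnerTwistCouplingInSupply`) are
checked for the family, so that the corner is an instance of the crux's hypothesis class and not a statement about curves the crux never sees:

* `cmFieldDiscrOfJ_W` — `d_K(W_p) = −7` (`j(W_p) = −3375`); ★ `cmInert_W` — **`CMInert W_p p`** (`p ∤ 7`; `−7` is a non-residue mod `p ≡ 3 (mod 4)`
  with `(p/7) = −1`: `…SqrtSevenLocal.not_isSquare_neg_seven_of_mod_four_eq_three`);
* ★ `not_good_W` — **`¬ Good W_p p`** (`W_p` is globally minimal with `Δ_min = −7³p⁶`, `p ∣ Δ_min`: tree theorem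
  `not_hasGoodReductionAtPrime_of_dvd_minimalDiscriminantInt`);
* ★★ `crux_hypotheses_W` — all binders and the hypotheses `HasCM`, `CMInert`, `¬ Good` together; ★★ `heegnerTwistCouplingInSupply_on_W` — the crux
  implication VERBATIM (hypotheses `HasCM → r_an = 1 → 5 ≤ p → CMInert → ¬ Good → supply → …`) for `W = W_p`, `p ≡ 3, 19, 27 (mod 56)`, modulo the
  two named facts (the hypotheses are not used — the conclusion holds outright on this family).

Not proved (and not provable by descent): `r_an(W_p) = 1` (the family has root number `−1`; the crux ASSUMES analytic rank one). HONEST FRAMING: one CM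
family; C⁺ untouched; crux 21381 NOT closed; BSD is not proved by any of this. THEOREMS ONLY.
-/

noncomputable section

open scoped Classical NumberField

namespace Summit.BirchSwinnertonDyer.BirchSwinnertonDyer.Theorems.BiquadraticEisensteinDescentHeegnerTwistCouplingInSupplySqrtSevenCornerInstance

open _root_.WeierstrassCurve Literature.NumberTheory.EllipticCurves Literature.NumberTheory.EllipticCurves.Rank1Residual
open Summit.BirchSwinnertonDyer.BirchSwinnertonDyer.Theorems.BiquadraticEisensteinDescentHeegnerTwistCouplingInSupplySqrtSevenLocal
  (not_isSquare_neg_seven_of_mod_four_eq_three)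
open Summit.BirchSwinnertonDyer.BirchSwinnertonDyer.Theorems.BiquadraticEisensteinDescentHeegnerTwistCouplingInSupplySqrtSevenCorner

/-- `d_K = −7` for the family: `cmFieldDiscrOfJ (j(W_p)) = −7`. [cite: SilvermanATAEC1994, App. A §3 (D = −7)] -/
theorem cmFieldDiscrOfJ_W {p : ℕ} (hp : p.Prime) (hp4 : p % 4 = 3)
    [hE : (⟨1, -(((21 * p + 1) / 4 : ℕ) : ℚ), 0, 7 * (p : ℚ) ^ 2, 0⟩ : WeierstrassCurve ℚ).IsElliptic] :
    cmFieldDiscrOfJ (⟨1, -(((21 * p + 1) / 4 : ℕ) : ℚ), 0, 7 * (p : ℚ) ^ 2, 0⟩ : WeierstrassCurve ℚ).j = -7 := by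
  rw [(j_W_and_hasCM hp hp4).1]
  norm_num [cmFieldDiscrOfJ]

/-- ★ **`CMInert W_p p`**: `p` is inert in the CM field `ℚ(√−7)` of `W_p` (`p ∤ 7`, `(−7/p) = −1`) — the crux hypothesis, for every prime `p ≡ 3 (mod 8)`
with `p ≡ 3, 5, 6 (mod 7)`. [cite: Cox2013, Prop. 5.16 and Cor. 5.17] -/
theorem cmInert_W {p : ℕ} [Fact p.Prime] (hp8 : p % 8 = 3) (hp7 : p % 7 = 3 ∨ p % 7 = 5 ∨ p % 7 = 6)
    [hE : (⟨1, -(((21 * p + 1) / 4 : ℕ) : ℚ), 0, 7 * (p : ℚ) ^ 2, 0⟩ : WeierstrassCurve ℚ).IsElliptic] :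
    CMInert (⟨1, -(((21 * p + 1) / 4 : ℕ) : ℚ), 0, 7 * (p : ℚ) ^ 2, 0⟩ : WeierstrassCurve ℚ) p := by
  have hp : p.Prime := Fact.out
  have hd := cmFieldDiscrOfJ_W hp (by omega)
  have h7 : ¬ (p : ℤ) ∣ -7 := by
    rw [dvd_neg]
    intro h
    have : p ∣ 7 := by exact_mod_cast h
    have := (Nat.prime_dvd_prime_iff_eq hp (by norm_num)).mp this
    omega
  refine ⟨fun h => h7 (by rwa [CMRamified, hd] at h), fun h => ?_⟩
  rw [CMSplit, hd, if_neg (by rintro rfl; omega)] at h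
  exact not_isSquare_neg_seven_of_mod_four_eq_three (q := p) (by omega) hp7 h.2

/-- ★ **`¬ Good W_p p`**: `W_p` has bad (additive) reduction at `p` — it is a global minimal equation (`isGloballyMinimal_W`) with `p ∣ Δ_min = −7³p⁶`.
[cite: SilvermanAEC2009, VII.5 Prop. 5.1(a) and VII.1 Prop. 1.3(b)] -/
theorem not_good_W {p : ℕ} [Fact p.Prime] (hp8 : p % 8 = 3) (hp7 : p % 7 = 3 ∨ p % 7 = 5 ∨ p % 7 = 6) :
    ¬ Good (⟨1, -(((21 * p + 1) / 4 : ℕ) : ℚ), 0, 7 * (p : ℚ) ^ 2, 0⟩ : WeierstrassCurve ℚ) p := by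
  have hp : p.Prime := Fact.out
  haveI := isGloballyMinimal_W hp (by omega) (by rintro rfl; omega)
  refine not_hasGoodReductionAtPrime_of_dvd_minimalDiscriminantInt _ p ?_
  have hcast := cast_minimalDiscriminantInt (⟨1, -(((21 * p + 1) / 4 : ℕ) : ℚ), 0, 7 * (p : ℚ) ^ 2, 0⟩ : WeierstrassCurve ℚ)
  rw [W_Δ p (by omega)] at hcast
  have hmin : minimalDiscriminantInt (⟨1, -(((21 * p + 1) / 4 : ℕ) : ℚ), 0, 7 * (p : ℚ) ^ 2, 0⟩ : WeierstrassCurve ℚ) = -343 * (p : ℤ) ^ 6 := by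
    exact_mod_cast hcast
  rw [hmin]
  exact Dvd.dvd.mul_left (dvd_pow_self _ (by norm_num)) _

/-- ★★ **All binders and hypotheses of crux 21381 — except `r_an = 1`, which the crux assumes — hold for `(W_p, p)`**, every prime `p ≡ 3 (mod 8)` with
`p ≡ 3, 5, 6 (mod 7)`: `IsElliptic`, `IsGloballyMinimal`, `NeZero N`, `HasCM`, `CMInert W_p p`, `¬ Good W_p p`. [cite: SilvermanAEC2009, VII.1 Remark 1.1] -/
theorem crux_hypotheses_W {p : ℕ} [Fact p.Prime] (hp8 : p % 8 = 3) (hp7 : p % 7 = 3 ∨ p % 7 = 5 ∨ p % 7 = 6) :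
    ∃ (_ : (⟨1, -(((21 * p + 1) / 4 : ℕ) : ℚ), 0, 7 * (p : ℚ) ^ 2, 0⟩ : WeierstrassCurve ℚ).IsElliptic)
      (_ : (⟨1, -(((21 * p + 1) / 4 : ℕ) : ℚ), 0, 7 * (p : ℚ) ^ 2, 0⟩ : WeierstrassCurve ℚ).IsGloballyMinimal)
      (_ : NeZero ((⟨1, -(((21 * p + 1) / 4 : ℕ) : ℚ), 0, 7 * (p : ℚ) ^ 2, 0⟩ : WeierstrassCurve ℚ).conductorNorm ℤ)),
      (⟨1, -(((21 * p + 1) / 4 : ℕ) : ℚ), 0, 7 * (p : ℚ) ^ 2, 0⟩ : WeierstrassCurve ℚ).HasCM ∧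
      CMInert (⟨1, -(((21 * p + 1) / 4 : ℕ) : ℚ), 0, 7 * (p : ℚ) ^ 2, 0⟩ : WeierstrassCurve ℚ) p ∧
      ¬ Good (⟨1, -(((21 * p + 1) / 4 : ℕ) : ℚ), 0, 7 * (p : ℚ) ^ 2, 0⟩ : WeierstrassCurve ℚ) p := by
  have hp : p.Prime := Fact.out
  obtain ⟨hE, hmin, hN, hCM⟩ := binders_W hp hp8 hp7
  exact ⟨hE, hmin, hN, hCM, cmInert_W hp8 hp7, not_good_W hp8 hp7⟩

/-- ★★ **Crux 21381 verbatim on the family**: for every prime `p` with `p ≡ 3 (mod 8)`, `p ≡ 3, 5, 6 (mod 7)` and `W = W_p`, the implication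
`HeegnerTwistCouplingInSupply` (binders `IsElliptic`, `IsGloballyMinimal`, `Fact p.Prime`, `NeZero N`; hypotheses `HasCM → r_an = 1 → 5 ≤ p → CMInert →
¬ Good → supply → ∃ K′ …`) HOLDS, modulo Burungale–Tian + Deuring–Hecke — because its conclusion holds outright (`cruxOnSqrtSevenCorner_of_two_facts`).
The crux itself (ALL CM `W`) is not closed by this; BSD is not proved by this. [cite: BurungaleTian2026, Thm. 1.1] [cite: SilvermanATAEC1994, Ch. II Cor. 10.5.1] -/
theorem heegnerTwistCouplingInSupply_on_W (hBT : burungaleTian_analyticRank_eq_zero_of_selmerCorank_eq_zero_of_hasCM)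
    (hH : hasEntireLFunction_of_j_mem_maximalCMJInvariants) {p : ℕ} (hp8 : p % 8 = 3) (hp7 : p % 7 = 3 ∨ p % 7 = 5 ∨ p % 7 = 6)
    [Fact p.Prime] [(⟨1, -(((21 * p + 1) / 4 : ℕ) : ℚ), 0, 7 * (p : ℚ) ^ 2, 0⟩ : WeierstrassCurve ℚ).IsElliptic]
    [(⟨1, -(((21 * p + 1) / 4 : ℕ) : ℚ), 0, 7 * (p : ℚ) ^ 2, 0⟩ : WeierstrassCurve ℚ).IsGloballyMinimal]
    [NeZero ((⟨1, -(((21 * p + 1) / 4 : ℕ) : ℚ), 0, 7 * (p : ℚ) ^ 2, 0⟩ : WeierstrassCurve ℚ).conductorNorm ℤ)] :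
    (⟨1, -(((21 * p + 1) / 4 : ℕ) : ℚ), 0, 7 * (p : ℚ) ^ 2, 0⟩ : WeierstrassCurve ℚ).HasCM →
    (⟨1, -(((21 * p + 1) / 4 : ℕ) : ℚ), 0, 7 * (p : ℚ) ^ 2, 0⟩ : WeierstrassCurve ℚ).analyticRank = 1 → 5 ≤ p →
    CMInert (⟨1, -(((21 * p + 1) / 4 : ℕ) : ℚ), 0, 7 * (p : ℚ) ^ 2, 0⟩ : WeierstrassCurve ℚ) p →
    ¬ Good (⟨1, -(((21 * p + 1) / 4 : ℕ) : ℚ), 0, 7 * (p : ℚ) ^ 2, 0⟩ : WeierstrassCurve ℚ) p →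
    (∀ B : ℕ, ∃ (K : Type) (_ : Field K) (_ : NumberField K), IsImaginaryQuadratic K ∧ B < (NumberField.discr K).natAbs ∧
      4 < (NumberField.discr K).natAbs ∧
      SatisfiesHeegnerHypothesis ((⟨1, -(((21 * p + 1) / 4 : ℕ) : ℚ), 0, 7 * (p : ℚ) ^ 2, 0⟩ : WeierstrassCurve ℚ).conductorNorm ℤ) K ∧
      ¬ p ∣ NumberField.classNumber K) →
    ∃ (K : Type) (_ : Field K) (_ : NumberField K), IsImaginaryQuadratic K ∧ 4 < (NumberField.discr K).natAbs ∧
      SatisfiesHeegnerHypothesis ((⟨1, -(((21 * p + 1) / 4 : ℕ) : ℚ), 0, 7 * (p : ℚ) ^ 2, 0⟩ : WeierstrassCurve ℚ).conductorNorm ℤ) K ∧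
      ((⟨1, -(((21 * p + 1) / 4 : ℕ) : ℚ), 0, 7 * (p : ℚ) ^ 2, 0⟩ : WeierstrassCurve ℚ).quadraticTwist
        (NumberField.discr K : ℚ)).entireLFunction 1 ≠ 0 ∧
      ¬ p ∣ NumberField.classNumber K :=
  fun _ _ hp5 _ _ _ => by
    obtain ⟨K, iF, iN, hK, h4, hHg, hL, -, hndvd⟩ := cruxOnSqrtSevenCorner_of_two_facts hBT hH p hp5 hp8 hp7
    exact ⟨K, iF, iN, hK, h4, hHg, hL, hndvd⟩

end Summit.BirchSwinnertonDyer.BirchSwinnertonDyer.Theorems.BiquadraticEisensteinDescentHeegnerTwistCouplingInSupplySqrtSevenCornerInstance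

end
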